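import Summits.HodgeConjecture.HodgeConjecture.Theorems.F0P6bWDock   -- ★ twin of ED. 4 7d61e77295a90030 (re-homed, LEAD «M-72»∕«M-79»∕«M-83»; Theorems lane, namespace KEPT; dealer LA7-plan (g4) #21A∕B∕C∕D, hand LA7-p02 (g3): p850397 `…Package` ∕ p850411 `…WBlockLaw` ∕ p850423 `…Seams` ∕ p850439 this)
import HarnessLib

/-! # F0_P6b_WDock — ED. 5 = SHIM (re-home, IMPORT-ONLY).  The `w`-block dock's declarations now live, under the SAME fully-qualified names
(namespace `Summit.HodgeConjecture.HodgeConjecture.Cruxes.HLiu418.F0P6bWDock` kept, incl. the sub-namespaces `WBlockLaw`, `WBlockLawED4b`, `WBlockLawED4c`,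
`WBlockLawLA3`), in ★ `Theorems/F0P6bWDockPackage.lean` (§1–§3: `WDockPackage`, `wDockPackage_of_line`, the base-change and prime-to-`p` heads), ★
`Theorems/F0P6bWDockWBlockLaw.lean` (§6–§6.5 `WBlockLaw`: `rL_W`, `rL_W'`, `law_w`, `hqβ_of_roof4`, …), ★ `Theorems/F0P6bWDockSeams.lean` (§4 (D-R) seam, §6.6 `WBlockLawED4b`,
§6.7 `WBlockLawED4c`) and ★ `Theorems/F0P6bWDock.lean` (§6.8 `WBlockLawLA3`; transitively all four) — the tree bytes of ED. 4 split ×4 by the size lint with the two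
`Lines/` imports of ED. 4 already switched to their ★ re-homes (★ `Theorems.F0P6bWeilCartierDuality` = the W-line, ★ `Literature…Motives.AbelianVarietyFrobeniusBlockLagrangian`
= (BLF)), 0 statement ∕ proof bytes changed; this file only imports the last, so the module `…Cruxes.HLiu418.Lines.F0_P6b_WDock` keeps serving all 41 names to any importer
(tree `.lean` importers: none — the dock is a leaf; its consumers (GEN ∕ L3 ROOF road) import the ★ module directly from now on).  It declares nothing.  Edition history
ED. 1–4 (ED. 3′ «WBlockLaw», ED. 4 §6.6–§6.8) stays in the line card `Lines/F0_P6b_WDock.md` and in git; the ED. 5 cand v2 cfd818b4f99d4faf («★-import switch» of the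
1 226-line body) is SUPERSEDED unwritten by this shim because #21A–D landed ★ (08:14Z) before the batch-1 box; future changes to the dock are ★-side proposals on the
four `Theorems/` files.  HC_CM is proved only modulo the 7 printed citations (2 remaining named inputs hLiu418 = stmt-HodgeConjecture-24832, h413 = stmt-HodgeConjecture-24833)
until rung 0 closes; count-neutral (0 `sorry`, 0 socket, 0 declaration). -/
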